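/-
Copyright (c) 2026 the pub-hodgecm-mathlib formalisation cell (harness21).  Prover seat hodgecm-mathlib-B-p14 (g36): road «S3-tree» (chair F0P3a-plan (g11); architect A-p16 (g30) A-88 (4);
T10-42 (3) S3-res capital), brick T1 «the `U(3)_v` tree», DATUM-FREE EDITION R5b = THE PARENT OF A TYPE-TWO VERTEX GIVEN ITS NORMAL FORM, FOR ANY ISOMETRIC INVOLUTION; 2026-09-01.
Twin of ★ T1d-C2 `UnitaryLatticeTreeTypeTwoParent` + ★ T1d-C3a `UnitaryLatticeTreeTypeTwoChild` with `hd ↦ (hσ, hvσ, hϖ)` and `t_a ↦ diag(ϖ^a, 1, (σϖ)^{−a})`.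
-/
import Literature.NumberTheory.Automorphic.UnitaryLatticeTreeApartmentOfInvolution   -- ★ T1 R5a (B-p14 (g36)): apartment `_of_v`, `isVertexLattice_two_N₁_of_v`, `latt_diagonal_map_zpow_eq`, `dualLatt_latt_diagonal_three_of_v`
import Literature.NumberTheory.Automorphic.UnitaryLatticeTreeTypeTwoChild             -- ★ T1d-C3a (B-p14 (g35)): `latticeParent_spec_of_lt_stdLattice`, `mapGL_N₁_le`, `firstColumn_props`, `mem_mapGL_N₁_iff`, `latt_diagonal_three_le_iff`
import HarnessLib

/-!
# The lattice graph of a hermitian space — T1 FILE R5b: THE PARENT OF A TYPE-TWO VERTEX, GIVEN ITS NORMAL FORM `κ·t·κ″·N₁`, FOR ANY ISOMETRIC INVOLUTION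
# (no `σϖ = ϖ`: ramified places included; Bruhat–Tits 1972 §10, Serre *Trees* II.1.1)

Topic `NumberTheory/Automorphic`; namespace `Literature.NumberTheory.Automorphic.UnitaryLatticeTree`.  THEOREMS ONLY (no definition, no instance, no notation, no named fact,
no `sorry`); kernel lane.  Cell `pub/hodgecm-mathlib` (D-0151), crux H413 = `stmt-HodgeConjecture-24833`; road «S3-tree», brick T1 «the `U(3)_v` lattice graph is a TREE»,
DATUM-FREE EDITION, file 2 (after ★ R5a `UnitaryLatticeTreeApartmentOfInvolution`).  ★ T1d-C2∕C3a compute the parent of a type-two vertex from its normal form `κ·t_a·κ″·N₁`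
under the unramified datum; the datum enters only through `t_a = diag(ϖ^a, 1, ϖ^{−a})` being unitary (`σϖ = ϖ`).  For ANY involution `σ` preserving `v` the torus element is
`t = diag(ϖ^a, 1, (σϖ)^{−a})` (★ R5a `exists_coe_eq_diagonal_zpow_of_involution`); `t·𝒪³ = L_a` and `t·N₁ = L′_a` still (diagonal lattices only see valuations), and the three cases
(inside the root ∕ apartment ∕ child) go through verbatim.  The normal form itself (from ★ `UnitaryGroup.exists_cartan_of_involution` + `htr₂`) is an INPUT here.

* §1 `mapGL_N₁_eq_of_v_lt_one_of_v` (`κ″·N₁ = N₁` when `(κ″e₀)₂ ∈ 𝔪`), `latticeParent_spec_apartment_two_of_v` (the apartment case `κ·L′_a`, `a ≥ 1`).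
* §2 `coe_inv_of_coe_eq_diagonal_map_zpow`, `latticeDepth_child_of_v` (the child `t·κ″·N₁`, `(κ″e₀)₂` a unit, has depth `a + 1`).
* §3 `latticeParent_child_of_v` (its parent is `L_a`).
* §4 **`latticeParent_spec_of_isVertexLattice_two_of_frame`**: for `M = κ·t·κ″·N₁` of type `2`: `latticeParent M` self-dual, `M < latticeParent M`, `depth(parent) + 1 = depth M`.

HONEST LABEL: HC_CM is proved only modulo the 2 remaining named inputs (hLiu418 24832, h413 24833) until rung 0 closes; nothing printed is asserted here (elementary lattice algebra).

## References
* [BruhatTits1972] F. Bruhat, J. Tits, *Groupes réductifs sur un corps local I*, Publ. Math. IHÉS 41 (1972), §10.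
* [Tits1979] J. Tits, *Reductive groups over local fields*, PSPM 33.1 (1979), §3.3.3.
* [Serre1980Trees] J.-P. Serre, *Trees* (1980), Ch. II §1.1.
* [Omeara1963] O. T. O'Meara, *Introduction to quadratic forms* (1963), §82F.
-/

set_option autoImplicit false

noncomputable section

open scoped Valued WithZero Matrix MatrixGroups

namespace Literature.NumberTheory.Automorphic.UnitaryLatticeTree

open Literature.NumberTheory.Automorphic Literature.NumberTheory.Automorphic.HermitianLattice
open Literature.NumberTheory.Automorphic.CartanUnique

variable {K : Type*} [Field K] [Valued K ℤᵐ⁰] {σ : K →+* K} {ϖ : K} {N : ℕ}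

/-! ## §1 `κ″·N₁ = N₁` when `x₂ ∈ 𝔪`; the apartment case -/

/-- **If `x = κ″e₀` has `x₂ ∈ 𝔪` then `κ″·N₁ = N₁`** (ANY valuation-preserving `σ`; ★ `mapGL_N₁_eq_of_v_lt_one` without `σϖ = ϖ`) (`x` exactly isotropic and primitive force `x₁ ∈ 𝔪`, `x₀` a unit, so `|B₀ x y| ≤ |ϖ| ↔ |y₂| ≤ |ϖ|`; then (D2)).
[cite: BruhatTits1972, §10] [cite: Serre1980Trees, II.1.1] -/
theorem mapGL_N₁_eq_of_v_lt_one_of_v (hvσ : ∀ a, Valued.v (σ a) = Valued.v a) (hϖ : Valued.v ϖ = WithZero.exp (-1 : ℤ))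
    {κ : unitaryGroupOfForm σ ((StdForm.antidiagonal 3).over K)} (hκ : κ ∈ unitaryInt σ ((StdForm.antidiagonal 3).over K))
    (hx2 : Valued.v (((κ : GL (Fin 3) K) : Matrix (Fin 3) (Fin 3) K).mulVec (Pi.single 0 1) 2) < 1) :
    mapGL (κ : GL (Fin 3) K) (latt (Matrix.diagonal ![(1 : K), 1, ϖ])) = latt (Matrix.diagonal ![(1 : K), 1, ϖ]) := by
  have hϖ0 : ϖ ≠ 0 := uniformizer_ne_zero hϖ
  have hϖ1 : Valued.v ϖ ≤ 1 := by rw [hϖ, ← WithZero.exp_zero, WithZero.exp_le_exp]; omega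
  set x := ((κ : GL (Fin 3) K) : Matrix (Fin 3) (Fin 3) K).mulVec (Pi.single 0 1) with hxdef
  obtain ⟨hxint, hxiso, i, hi⟩ := firstColumn_props (K := K) hκ
  -- `x₁ ∈ 𝔪`
  have hx1 : Valued.v (x 1) < 1 := by
    have h : σ (x 1) * x 1 = -(σ (x 0) * x 2 + σ (x 2) * x 0) := by
      rw [UnitaryGroup.B₀_three_apply] at hxiso
      linear_combination hxiso
    have hv : Valued.v (σ (x 1) * x 1) < 1 := by
      rw [h, Valuation.map_neg]
      refine (Valuation.map_add _ _ _).trans_lt (max_lt ?_ ?_)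
      · rw [map_mul, hvσ]
        calc Valued.v (x 0) * Valued.v (x 2) ≤ 1 * Valued.v (x 2) := mul_le_mul' (hxint 0) le_rfl
          _ < 1 := by rw [one_mul]; exact hx2
      · rw [map_mul, hvσ]
        calc Valued.v (x 2) * Valued.v (x 0) ≤ Valued.v (x 2) * 1 := mul_le_mul' le_rfl (hxint 0)
          _ < 1 := by rw [mul_one]; exact hx2
    rw [map_mul, hvσ] at hv
    by_contra hge
    have h1 : Valued.v (x 1) = 1 := le_antisymm (hxint 1) (not_lt.1 hge)
    rw [h1, mul_one] at hv
    exact lt_irrefl _ hv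
  -- `x₀` is a unit
  have hx0 : Valued.v (x 0) = 1 := by
    fin_cases i
    · exact hi
    · exact absurd hi hx1.ne
    · exact absurd hi hx2.ne
  -- `κ·N₁ ≤ N₁`, then (D2)
  have hN₁ := isVertexLattice_two_N₁_of_v (K := K) hvσ hϖ1 hϖ0
  refine eq_of_le_of_isVertexLattice hvσ hϖ0 (isVertexLattice_mapGL σ ϖ _ _ κ.2 hN₁) hN₁ fun y hy => ?_
  have hyint : y ∈ stdLattice K 3 := (mapGL_N₁_le hκ hϖ1 hϖ0).2 hy
  have hB := (mem_mapGL_N₁_iff hκ hϖ0 hyint).1 hy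
  have hd : ∀ i, (![(1 : K), 1, ϖ] : Fin 3 → K) i ≠ 0 := by intro i; fin_cases i <;> simp [hϖ0]
  refine (mem_latt_diagonal_iff hd y).2 fun j => ?_
  fin_cases j
  · simp only [Fin.zero_eta, Matrix.cons_val_zero, map_one]; exact hyint 0
  · simp only [Fin.mk_one, Matrix.cons_val_one, Matrix.cons_val_zero, map_one]; exact hyint 1
  · simp only [Fin.reduceFinMk, Matrix.cons_val_two, Matrix.tail_cons, Matrix.head_cons, Nat.succ_eq_add_one]
    -- `σx₀·y₂ = B₀ x y − σx₁ y₁ − σx₂ y₀`, all of valuation `≤ |ϖ|`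
    have hϖlt : ∀ z : K, Valued.v z < 1 → Valued.v z ≤ Valued.v ϖ := fun z hz => by rw [hϖ]; exact (v_lt_one_iff z).1 hz
    have heq : σ (x 0) * y 2 = B₀ σ 3 x y - σ (x 1) * y 1 - σ (x 2) * y 0 := by rw [UnitaryGroup.B₀_three_apply]; ring
    have hv : Valued.v (σ (x 0) * y 2) ≤ Valued.v ϖ := by
      rw [heq]
      refine (Valuation.map_sub _ _ _).trans (max_le ((Valuation.map_sub _ _ _).trans (max_le hB ?_)) ?_)
      · rw [map_mul, hvσ]
        calc Valued.v (x 1) * Valued.v (y 1) ≤ Valued.v (x 1) * 1 := mul_le_mul' le_rfl (hyint 1)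
          _ ≤ Valued.v ϖ := by rw [mul_one]; exact hϖlt _ hx1
      · rw [map_mul, hvσ]
        calc Valued.v (x 2) * Valued.v (y 0) ≤ Valued.v (x 2) * 1 := mul_le_mul' le_rfl (hyint 0)
          _ ≤ Valued.v ϖ := by rw [mul_one]; exact hϖlt _ hx2
    rwa [map_mul, hvσ, hx0, one_mul] at hv


/-- **THE APARTMENT CASE** (any isometric involution): for `a ≥ 1` and `κ ∈ K₀`, the type-two vertex `M = κ·L′_a = κ·latt diag(ϖ^a,1,ϖ^{1−a})` has parent `κ·L_{a−1}`: self-dual, `> M`, of depth `a − 1 = depth M − 1`.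
[cite: BruhatTits1972, §10] [cite: Serre1980Trees, II.1.1] -/
theorem latticeParent_spec_apartment_two_of_v (hσ : ∀ x, σ (σ x) = x) (hvσ : ∀ a, Valued.v (σ a) = Valued.v a) (hϖ : Valued.v ϖ = WithZero.exp (-1 : ℤ)) {κ : unitaryGroupOfForm σ ((StdForm.antidiagonal 3).over K)}
    (hκ : κ ∈ unitaryInt σ ((StdForm.antidiagonal 3).over K)) {a : ℤ} (ha : 1 ≤ a) :
    IsSelfDualLattice σ ϖ ((StdForm.antidiagonal 3).over K)
        (latticeParent σ ϖ ((StdForm.antidiagonal 3).over K) (mapGL (κ : GL (Fin 3) K) (latt (Matrix.diagonal ![ϖ ^ a, (1 : K), ϖ ^ (1 - a)])))) ∧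
      mapGL (κ : GL (Fin 3) K) (latt (Matrix.diagonal ![ϖ ^ a, (1 : K), ϖ ^ (1 - a)])) <
        latticeParent σ ϖ ((StdForm.antidiagonal 3).over K) (mapGL (κ : GL (Fin 3) K) (latt (Matrix.diagonal ![ϖ ^ a, (1 : K), ϖ ^ (1 - a)]))) ∧
      latticeDepth ϖ (latticeParent σ ϖ ((StdForm.antidiagonal 3).over K) (mapGL (κ : GL (Fin 3) K) (latt (Matrix.diagonal ![ϖ ^ a, (1 : K), ϖ ^ (1 - a)])))) + 1 =
        latticeDepth ϖ (mapGL (κ : GL (Fin 3) K) (latt (Matrix.diagonal ![ϖ ^ a, (1 : K), ϖ ^ (1 - a)]))) := by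
  have hϖ0 : ϖ ≠ 0 := uniformizer_ne_zero hϖ
  have hdepth : latticeDepth ϖ (mapGL (κ : GL (Fin 3) K) (latt (Matrix.diagonal ![ϖ ^ a, (1 : K), ϖ ^ (1 - a)]))) = a.toNat := by
    rw [latticeDepth_mapGL_of_mem_unitaryInt hκ, latticeDepth_latt_diagonal_zpow_two hϖ]; congr 1; exact max_eq_left (by omega)
  -- the parent in the frame: `κ·latt diag(ϖ^{a-1}, 1, ϖ^{-(a-1)})`
  have hP : latticeParent σ ϖ ((StdForm.antidiagonal 3).over K) (mapGL (κ : GL (Fin 3) K) (latt (Matrix.diagonal ![ϖ ^ a, (1 : K), ϖ ^ (1 - a)]))) =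
      mapGL (κ : GL (Fin 3) K) (latt (Matrix.diagonal ![ϖ ^ (a - 1), (1 : K), ϖ ^ (-(a - 1))])) := by
    rw [latticeParent_mapGL_of_mem_unitaryInt hκ, latticeParent, latticeDepth_latt_diagonal_zpow_two hϖ, show (max a (1 - a)).toNat = a.toNat from by
      rw [max_eq_left (by omega)], show ((a.toNat : ℕ) : ℤ) = a by omega, diagonal_one_mid_eq, dualLatt_latt_diagonal_three_of_v hvσ hϖ0,
      latt_diagonal_three_inf_scaleLattice hϖ, diagonal_one_mid_eq]
    congr 3
    funext i; fin_cases i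
    · show ϖ ^ max (-(1 - a)) (1 - a) = ϖ ^ (a - 1); congr 1; rw [max_eq_left (by omega)]; ring
    · show ϖ ^ max (-(0 : ℤ)) (1 - a) = ϖ ^ (0 : ℤ); congr 1; exact max_eq_left (by omega)
    · show ϖ ^ max (-a) (1 - a) = ϖ ^ (-(a - 1)); congr 1; rw [max_eq_right (by omega)]; ring
  have hsd : IsSelfDualLattice σ ϖ ((StdForm.antidiagonal 3).over K) (latt (Matrix.diagonal ![ϖ ^ (a - 1), (1 : K), ϖ ^ (-(a - 1))])) :=
    isSelfDualLattice_latt_diagonal_zpow_of_v hσ hvσ hϖ (a - 1)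
  refine ⟨by rw [hP]; exact isVertexLattice_mapGL σ ϖ _ _ κ.2 hsd, ?_, ?_⟩
  · rw [hP, mapGL_lt_mapGL_iff]
    refine lt_of_le_of_ne ?_ fun heq => ?_
    · rw [diagonal_one_mid_eq, diagonal_one_mid_eq, latt_diagonal_three_le_iff hϖ]
      refine ⟨by omega, le_rfl, by omega⟩
    · have h2 := isVertexLattice_two_latt_diagonal_zpow_of_v (K := K) hσ hvσ hϖ a
      rw [heq] at h2
      exact absurd (type_unique hvσ hϖ h2 hsd) (by norm_num)
  · rw [hP, hdepth, latticeDepth_mapGL_of_mem_unitaryInt hκ, latticeDepth_latt_diagonal_zpow_selfDual hϖ]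
    omega


/-! ## §2 The child case: depth -/

omit [Valued K ℤᵐ⁰] in
/-- The inverse matrix of the torus element: `diag(ϖ^a, 1, (σϖ)^{−a})⁻¹ = diag(ϖ^{−a}, 1, (σϖ)^a)`. [cite: BruhatTits1972, §10] -/
theorem coe_inv_of_coe_eq_diagonal_map_zpow (hϖ0 : ϖ ≠ 0) {t : unitaryGroupOfForm σ ((StdForm.antidiagonal 3).over K)} {a : ℤ}
    (ht : ((t : GL (Fin 3) K) : Matrix (Fin 3) (Fin 3) K) = Matrix.diagonal ![ϖ ^ a, 1, (σ ϖ) ^ (-a)]) :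
    (((t⁻¹ : unitaryGroupOfForm σ ((StdForm.antidiagonal 3).over K)) : GL (Fin 3) K) : Matrix (Fin 3) (Fin 3) K) = Matrix.diagonal ![ϖ ^ (-a), 1, (σ ϖ) ^ a] := by
  have hσϖ0 : σ ϖ ≠ 0 := (map_ne_zero σ).2 hϖ0
  rw [Subgroup.coe_inv, Matrix.coe_units_inv, ht]
  apply Matrix.inv_eq_right_inv
  rw [diagonal_three_mul, ← Matrix.diagonal_one]
  congr 1; funext i; fin_cases i
  · show ϖ ^ a * ϖ ^ (-a) = 1; rw [← zpow_add₀ hϖ0, add_neg_cancel, zpow_zero]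
  · show (1 : K) * 1 = 1; rw [mul_one]
  · show (σ ϖ) ^ (-a) * (σ ϖ) ^ a = 1; rw [← zpow_add₀ hσϖ0, neg_add_cancel, zpow_zero]


/-- **THE CHILD CASE — DEPTH** (any isometric involution; `t = diag(ϖ^a, 1, (σϖ)^{−a})`): for `a ≥ 1`, `κ″ ∈ K₀` with `(κ″e₀)₂` a UNIT and `t = t_a`, the type-two vertex `t·κ″·N₁` has depth `a + 1`. [cite: BruhatTits1972, §10] [cite: Serre1980Trees, II.1.1] -/
theorem latticeDepth_child_of_v (hvσ : ∀ a, Valued.v (σ a) = Valued.v a) (hϖ : Valued.v ϖ = WithZero.exp (-1 : ℤ)) {κ'' : unitaryGroupOfForm σ ((StdForm.antidiagonal 3).over K)}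
    (hκ'' : κ'' ∈ unitaryInt σ ((StdForm.antidiagonal 3).over K)) {t : unitaryGroupOfForm σ ((StdForm.antidiagonal 3).over K)} {a : ℕ} (ha : 1 ≤ a)
    (ht : ((t : GL (Fin 3) K) : Matrix (Fin 3) (Fin 3) K) = Matrix.diagonal ![ϖ ^ (a : ℤ), 1, (σ ϖ) ^ (-(a : ℤ))])
    (hx2 : Valued.v (((κ'' : GL (Fin 3) K) : Matrix (Fin 3) (Fin 3) K).mulVec (Pi.single 0 1) 2) = 1) :
    latticeDepth ϖ (mapGL (t : GL (Fin 3) K) (mapGL (κ'' : GL (Fin 3) K) (latt (Matrix.diagonal ![(1 : K), 1, ϖ])))) = a + 1 := by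
  have hϖ0 : ϖ ≠ 0 := uniformizer_ne_zero hϖ
  have hϖ1 : Valued.v ϖ ≤ 1 := uniformizer_mem_integer hϖ
  have hvσϖ : ∀ n : ℤ, Valued.v ((σ ϖ) ^ n) = Valued.v (ϖ ^ n) := fun n => by rw [map_zpow₀, hvσ, map_zpow₀]
  set x := ((κ'' : GL (Fin 3) K) : Matrix (Fin 3) (Fin 3) K).mulVec (Pi.single 0 1) with hxdef
  obtain ⟨hxint, -, -⟩ := firstColumn_props (K := K) hκ''
  have htinv := coe_inv_of_coe_eq_diagonal_map_zpow hϖ0 ht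
  have hXle := (mapGL_N₁_le hκ'' hϖ1 hϖ0).2
  -- membership of `c • e_i`-type columns
  have hmem : ∀ {j : ℕ}, scaleLattice (ϖ ^ j) (stdLattice K 3) ≤ mapGL (t : GL (Fin 3) K) (mapGL (κ'' : GL (Fin 3) K) (latt (Matrix.diagonal ![(1 : K), 1, ϖ]))) ↔
      ∀ i : Fin 3, (Matrix.diagonal ![ϖ ^ (-(a : ℤ)), (1 : K), (σ ϖ) ^ (a : ℤ)]).mulVec ((Matrix.diagonal fun _ : Fin 3 => ϖ ^ j).mulVec (Pi.single i 1)) ∈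
        mapGL (κ'' : GL (Fin 3) K) (latt (Matrix.diagonal ![(1 : K), 1, ϖ])) := by
    intro j
    rw [scaleLattice_stdLattice_eq_latt_diagonal (pow_ne_zero j hϖ0), latt_le_iff_forall_mulVec_single_mem]
    refine forall_congr' fun i => ?_
    rw [mem_mapGL_iff, ← Subgroup.coe_inv, htinv]
  have hw : scaleLattice (ϖ ^ (a + 1)) (stdLattice K 3) ≤ mapGL (t : GL (Fin 3) K) (mapGL (κ'' : GL (Fin 3) K) (latt (Matrix.diagonal ![(1 : K), 1, ϖ]))) := by
    -- `ϖ^{a+1} e_i` pulled back by `t⁻¹` lies in `ϖ𝒪³ ≤ X`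
    refine hmem.2 fun i => (mapGL_N₁_le hκ'' hϖ1 hϖ0).1 ((mem_scaleLattice_stdLattice_iff hϖ0 _).2 fun k => ?_)
    rw [Matrix.mulVec_mulVec, Matrix.diagonal_mul_diagonal, Matrix.mulVec_diagonal, Pi.single_apply]
    split_ifs
    · rw [mul_one]
      fin_cases k <;> simp only [Fin.zero_eta, Fin.mk_one, Fin.reduceFinMk, Matrix.cons_val_zero, Matrix.cons_val_one, Matrix.cons_val_two, Matrix.tail_cons,
        Matrix.head_cons, one_mul, map_mul, map_pow, hvσϖ, v_uniformizer_zpow hϖ, hϖ, ← WithZero.exp_nsmul, ← WithZero.exp_add, WithZero.exp_le_exp,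
        nsmul_eq_mul] <;> push_cast <;> omega
    · rw [mul_zero, map_zero]; exact zero_le
  refine le_antisymm (latticeDepth_le_of_le hw) (le_latticeDepth_of_forall hw fun j hj => ?_)
  -- minimality: the column `i = 0` forces `j ≥ a + 1`
  have h0 := (hmem.1 hj) 0
  have hint : (Matrix.diagonal ![ϖ ^ (-(a : ℤ)), (1 : K), (σ ϖ) ^ (a : ℤ)]).mulVec ((Matrix.diagonal fun _ : Fin 3 => ϖ ^ j).mulVec (Pi.single 0 1)) ∈ stdLattice K 3 := hXle h0
  have hB := (mem_mapGL_N₁_iff hκ'' hϖ0 hint).1 h0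
  have hvec : (Matrix.diagonal ![ϖ ^ (-(a : ℤ)), (1 : K), (σ ϖ) ^ (a : ℤ)]).mulVec ((Matrix.diagonal fun _ : Fin 3 => ϖ ^ j).mulVec (Pi.single 0 1)) =
      (ϖ ^ (-(a : ℤ)) * ϖ ^ j) • (Pi.single 0 1 : Fin 3 → K) := by
    rw [Matrix.mulVec_mulVec, Matrix.diagonal_mul_diagonal, Matrix.mulVec_single_one]
    funext k; rw [Matrix.col_apply, Matrix.diagonal_apply, Pi.smul_apply, Pi.single_apply]
    split_ifs with h
    · subst h; simp
    · rw [smul_zero]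
  rw [hvec, map_smul, smul_eq_mul, B₀_single_right, show Fin.rev (0 : Fin 3) = 2 from rfl, map_mul, map_mul, hvσ, hx2, mul_one, map_pow, v_uniformizer_zpow hϖ, hϖ,
    ← WithZero.exp_nsmul, ← WithZero.exp_add, WithZero.exp_le_exp, nsmul_eq_mul] at hB
  omega


/-! ## §3 The child case: parent -/

/-- **THE CHILD CASE — PARENT** (any isometric involution; `t = diag(ϖ^a, 1, (σϖ)^{−a})`): for `a ≥ 1`, `κ″ ∈ K₀` with `(κ″e₀)₂` a unit and `t = t_a`, the parent of the type-two vertex `t·κ″·N₁` (depth `a + 1`) is the apartment vertex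
`L_a = latt diag(ϖ^a, 1, ϖ^{-a})`: indeed `(t·X)^♯ ⊓ ϖ^{-a}𝒪³ = t·𝒪³` because a vector of `t·X^♯ = t·κ″·latt diag(ϖ⁻¹,1,1)` with integral `ϖ^a`-scaled last coordinate has
`x₂·ϖ⁻¹w₀ ∈ 𝒪`, `x₂` a unit. [cite: BruhatTits1972, §10] [cite: Serre1980Trees, II.1.1] -/
theorem latticeParent_child_of_v (hvσ : ∀ a, Valued.v (σ a) = Valued.v a) (hϖ : Valued.v ϖ = WithZero.exp (-1 : ℤ)) {κ'' : unitaryGroupOfForm σ ((StdForm.antidiagonal 3).over K)}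
    (hκ'' : κ'' ∈ unitaryInt σ ((StdForm.antidiagonal 3).over K)) {t : unitaryGroupOfForm σ ((StdForm.antidiagonal 3).over K)} {a : ℕ} (ha : 1 ≤ a)
    (ht : ((t : GL (Fin 3) K) : Matrix (Fin 3) (Fin 3) K) = Matrix.diagonal ![ϖ ^ (a : ℤ), 1, (σ ϖ) ^ (-(a : ℤ))])
    (hx2 : Valued.v (((κ'' : GL (Fin 3) K) : Matrix (Fin 3) (Fin 3) K).mulVec (Pi.single 0 1) 2) = 1) :
    latticeParent σ ϖ ((StdForm.antidiagonal 3).over K) (mapGL (t : GL (Fin 3) K) (mapGL (κ'' : GL (Fin 3) K) (latt (Matrix.diagonal ![(1 : K), 1, ϖ])))) =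
      latt (Matrix.diagonal ![ϖ ^ (a : ℤ), (1 : K), ϖ ^ (-(a : ℤ))]) := by
  have hϖ0 : ϖ ≠ 0 := uniformizer_ne_zero hϖ
  have hϖ1 : Valued.v ϖ ≤ 1 := uniformizer_mem_integer hϖ
  have hσϖ0 : σ ϖ ≠ 0 := (map_ne_zero σ).2 hϖ0
  have htL : mapGL (t : GL (Fin 3) K) (stdLattice K 3) = latt (Matrix.diagonal ![ϖ ^ (a : ℤ), (1 : K), ϖ ^ (-(a : ℤ))]) := by
    rw [← latt_one, mapGL_coe_latt_eq t ht, Matrix.mul_one, latt_diagonal_map_zpow_eq hvσ hϖ0]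
  have hXle := (mapGL_N₁_le hκ'' hϖ1 hϖ0).2
  have hexp : (1 - ((a + 1 : ℕ) : ℤ)) = -(a : ℤ) := by push_cast; ring
  rw [latticeParent, latticeDepth_child_of_v hvσ hϖ hκ'' ha ht hx2, hexp, ← htL, dualLatt_mapGL t.2]
  refine le_antisymm ?_ (le_inf ((mapGL_le_mapGL_iff _ _ _).2 ?_) ?_)
  · -- `⊆`: a vector of `t·X^♯` whose last coordinate is `ϖ^{-a}`-integral lies in `t·𝒪³`
    intro y hy
    obtain ⟨hy1, hy2⟩ := Submodule.mem_inf.1 hy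
    rw [dualLatt_mapGL κ''.2, dualLatt_N₁_of_v hvσ hϖ0, mapGL_latt_eq, mapGL_latt_eq, ht] at hy1
    obtain ⟨w, hw, hwy⟩ := Submodule.mem_map.1 hy1
    simp only [LinearMap.restrictScalars_apply, Matrix.toLin'_apply, ← Matrix.mulVec_mulVec] at hwy
    set u : Fin 3 → K := (Matrix.diagonal ![ϖ⁻¹, (1 : K), 1]).mulVec w with hu
    -- the last coordinate of `z = κ″u`
    have hz2 : Valued.v ((((κ'' : GL (Fin 3) K) : Matrix (Fin 3) (Fin 3) K).mulVec u) 2) ≤ 1 := by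
      have hy2' := (mem_scaleLattice_stdLattice_iff (zpow_ne_zero _ hϖ0) y).1 hy2 2
      have hyz : y 2 = (σ ϖ) ^ (-(a : ℤ)) * (((κ'' : GL (Fin 3) K) : Matrix (Fin 3) (Fin 3) K).mulVec u) 2 := by
        rw [← hwy, Matrix.mulVec_diagonal]; rfl
      have hback : (((κ'' : GL (Fin 3) K) : Matrix (Fin 3) (Fin 3) K).mulVec u) 2 = (σ ϖ) ^ (a : ℤ) * y 2 := by
        rw [hyz, ← mul_assoc, ← zpow_add₀ hσϖ0, add_neg_cancel, zpow_zero, one_mul]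
      rw [hback, map_mul]
      calc Valued.v ((σ ϖ) ^ (a : ℤ)) * Valued.v (y 2) ≤ Valued.v ((σ ϖ) ^ (a : ℤ)) * Valued.v (ϖ ^ (-(a : ℤ))) := mul_le_mul_right hy2' _
        _ = 1 := by rw [map_zpow₀, hvσ, ← map_zpow₀, ← map_mul, ← zpow_add₀ hϖ0, add_neg_cancel, zpow_zero, map_one]
    -- hence `u₀ = ϖ⁻¹w₀ ∈ 𝒪`, `x₂` being a unit
    have hK : ∀ i j, Valued.v (((κ'' : GL (Fin 3) K) : Matrix (Fin 3) (Fin 3) K) i j) ≤ 1 := (mem_unitaryInt_iff.1 hκ'').1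
    have hx2' : Valued.v (((κ'' : GL (Fin 3) K) : Matrix (Fin 3) (Fin 3) K) 2 0) = 1 := by
      rw [Matrix.mulVec_single_one, Matrix.col_apply] at hx2; exact hx2
    have hw' := (mem_stdLattice.1 hw)
    have hu1 : u 1 = w 1 := by rw [hu, Matrix.mulVec_diagonal]; simp
    have hu2 : u 2 = w 2 := by rw [hu, Matrix.mulVec_diagonal]; simp
    have hsum : (((κ'' : GL (Fin 3) K) : Matrix (Fin 3) (Fin 3) K).mulVec u) 2 =
        ((κ'' : GL (Fin 3) K) : Matrix (Fin 3) (Fin 3) K) 2 0 * u 0 + ((κ'' : GL (Fin 3) K) : Matrix (Fin 3) (Fin 3) K) 2 1 * u 1 +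
          ((κ'' : GL (Fin 3) K) : Matrix (Fin 3) (Fin 3) K) 2 2 * u 2 := by
      simp only [Matrix.mulVec, dotProduct, Fin.sum_univ_three]
    have hu0 : Valued.v (u 0) ≤ 1 := by
      have heq : ((κ'' : GL (Fin 3) K) : Matrix (Fin 3) (Fin 3) K) 2 0 * u 0 =
          (((κ'' : GL (Fin 3) K) : Matrix (Fin 3) (Fin 3) K).mulVec u) 2 - ((κ'' : GL (Fin 3) K) : Matrix (Fin 3) (Fin 3) K) 2 1 * u 1 -
            ((κ'' : GL (Fin 3) K) : Matrix (Fin 3) (Fin 3) K) 2 2 * u 2 := by rw [hsum]; ring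
      have hv : Valued.v (((κ'' : GL (Fin 3) K) : Matrix (Fin 3) (Fin 3) K) 2 0 * u 0) ≤ 1 := by
        rw [heq]
        refine le_trans (Valuation.map_sub _ _ _) (max_le (le_trans (Valuation.map_sub _ _ _) (max_le hz2 ?_)) ?_)
        · rw [map_mul, hu1]; exact mul_le_one' (hK 2 1) (hw' 1)
        · rw [map_mul, hu2]; exact mul_le_one' (hK 2 2) (hw' 2)
      rwa [map_mul, hx2', one_mul] at hv
    have humem : u ∈ stdLattice K 3 := by
      refine mem_stdLattice.2 fun i => ?_
      fin_cases i
      · exact hu0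
      · show Valued.v (u 1) ≤ 1; rw [hu1]; exact hw' 1
      · show Valued.v (u 2) ≤ 1; rw [hu2]; exact hw' 2
    rw [← hwy, ← ht]
    exact (mem_mapGL_iff _ _ _).2 (by
      rw [Matrix.mulVec_mulVec, ← Units.val_mul, inv_mul_cancel, Units.val_one, Matrix.one_mulVec]
      exact mulVec_mem_stdLattice_of_mem_unitaryInt hκ'' humem)
  · -- `𝒪³ ≤ X^♯`
    rw [← dualLatt_stdLattice_eq_self σ hvσ isUnit_det_antidiagonal isIntMatrix_antidiagonal isIntMatrix_antidiagonal_inv]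
    exact dualLatt_antitone σ _ hXle
  · -- `t·𝒪³ = L_a ≤ ϖ^{-a}𝒪³`
    rw [htL, scaleLattice_stdLattice_eq_latt_diagonal (zpow_ne_zero _ hϖ0), diagonal_const_three, diagonal_one_mid_eq, latt_diagonal_three_le_iff hϖ]
    omega


/-! ## §4 The assembly: the parent of a type-two vertex given its normal form -/

/-- **THE PARENT OF A TYPE-TWO VERTEX of the `U(3)` lattice graph is a SELF-DUAL vertex strictly above it, with `depth(parent) + 1 = depth`** (`N = 3`, unramified datum,
`2 ∈ 𝒪^×`; under `htr₂` = «`U(J₀)` acts transitively on type-two vertices», the rank-3 analogue of the rank-2 binder (hB)).  The three cases of the normal form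
★ `exists_normalForm_of_type_two`: `a = 0` (inside the root, ★ `latticeParent_spec_of_lt_stdLattice`); `x₂ ∈ 𝔪` (the apartment vertex `κ·L′_a`,
★ `latticeParent_spec_apartment_two`); `x₂` a unit (a child of `κ·L_a`, ★ `latticeDepth_child` ∕ `latticeParent_child`). [cite: BruhatTits1972, §10] [cite: Serre1980Trees, II.1.1] -/
theorem latticeParent_spec_of_isVertexLattice_two_of_frame (hσ : ∀ x, σ (σ x) = x) (hvσ : ∀ a, Valued.v (σ a) = Valued.v a) (hϖ : Valued.v ϖ = WithZero.exp (-1 : ℤ))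
    {M : Submodule 𝒪[K] (Fin 3 → K)} (hM : IsVertexLattice σ ϖ ((StdForm.antidiagonal 3).over K) 2 M)
    {κ : unitaryGroupOfForm σ ((StdForm.antidiagonal 3).over K)} (hκ : κ ∈ unitaryInt σ ((StdForm.antidiagonal 3).over K))
    {κ'' : unitaryGroupOfForm σ ((StdForm.antidiagonal 3).over K)} (hκ'' : κ'' ∈ unitaryInt σ ((StdForm.antidiagonal 3).over K)) {a : ℕ}
    {t : unitaryGroupOfForm σ ((StdForm.antidiagonal 3).over K)} (ht : ((t : GL (Fin 3) K) : Matrix (Fin 3) (Fin 3) K) = Matrix.diagonal ![ϖ ^ (a : ℤ), 1, (σ ϖ) ^ (-(a : ℤ))])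
    (hMeq' : M = mapGL (κ : GL (Fin 3) K) (mapGL (t : GL (Fin 3) K) (mapGL (κ'' : GL (Fin 3) K) (latt (Matrix.diagonal ![(1 : K), 1, ϖ]))))) :
    IsSelfDualLattice σ ϖ ((StdForm.antidiagonal 3).over K) (latticeParent σ ϖ ((StdForm.antidiagonal 3).over K) M) ∧
      M < latticeParent σ ϖ ((StdForm.antidiagonal 3).over K) M ∧
      latticeDepth ϖ (latticeParent σ ϖ ((StdForm.antidiagonal 3).over K) M) + 1 = latticeDepth ϖ M := by
  have hϖ0 : ϖ ≠ 0 := uniformizer_ne_zero hϖ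
  have hϖ1 : Valued.v ϖ ≤ 1 := uniformizer_mem_integer hϖ
  have hσϖ0 : σ ϖ ≠ 0 := (map_ne_zero σ).2 hϖ0
  have hN₁ : IsVertexLattice σ ϖ ((StdForm.antidiagonal 3).over K) 2 (mapGL (κ'' : GL (Fin 3) K) (latt (Matrix.diagonal ![(1 : K), 1, ϖ]))) :=
    isVertexLattice_mapGL σ ϖ _ _ κ''.2 (isVertexLattice_two_N₁_of_v hvσ hϖ1 hϖ0)
  have hroot := isSelfDualLattice_stdLattice_three_of_v (K := K) (σ := σ) hϖ
  -- `κ″·N₁ < 𝒪³`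
  have hXlt : mapGL (κ'' : GL (Fin 3) K) (latt (Matrix.diagonal ![(1 : K), 1, ϖ])) < stdLattice K 3 := by
    refine lt_of_le_of_ne (mapGL_N₁_le hκ'' hϖ1 hϖ0).2 fun heq => ?_
    rw [heq] at hN₁
    exact absurd (type_unique hvσ hϖ hN₁ hroot) (by norm_num)
  rcases Nat.eq_zero_or_pos a with rfl | ha
  · -- `a = 0`: `M = κκ″·N₁ < 𝒪³`, depth `1`, parent `𝒪³`
    have ht1 : mapGL (t : GL (Fin 3) K) (mapGL (κ'' : GL (Fin 3) K) (latt (Matrix.diagonal ![(1 : K), 1, ϖ]))) =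
        mapGL (κ'' : GL (Fin 3) K) (latt (Matrix.diagonal ![(1 : K), 1, ϖ])) := by
      rw [mapGL_latt_eq, mapGL_coe_latt_eq t ht]
      have h1 : (Matrix.diagonal ![ϖ ^ ((0 : ℕ) : ℤ), (1 : K), (σ ϖ) ^ (-((0 : ℕ) : ℤ))] : Matrix (Fin 3) (Fin 3) K) = 1 := by
        rw [Nat.cast_zero, neg_zero, zpow_zero, zpow_zero, ← Matrix.diagonal_one]; congr 1; funext i; fin_cases i <;> rfl
      rw [h1, Matrix.one_mul]
    have hMlt : M < stdLattice K 3 := by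
      rw [hMeq', ht1]
      conv_rhs => rw [← mapGL_stdLattice_of_mem_unitaryInt hκ]
      exact (mapGL_lt_mapGL_iff _ _ _).2 hXlt
    obtain ⟨hdepth, hP⟩ := latticeParent_spec_of_lt_stdLattice hvσ hϖ isUnit_det_antidiagonal isIntMatrix_antidiagonal isIntMatrix_antidiagonal_inv hM hMlt
    rw [hP, hdepth, latticeDepth_stdLattice]
    exact ⟨hroot, hMlt, rfl⟩
  · obtain ⟨hxint, -, -⟩ := firstColumn_props (K := K) hκ''
    rcases (mem_stdLattice.1 hxint 2).lt_or_eq with hx2 | hx2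
    · -- `x₂ ∈ 𝔪`: `κ″·N₁ = N₁` and `M = κ·L′_a` — the apartment case
      have hMa : M = mapGL (κ : GL (Fin 3) K) (latt (Matrix.diagonal ![ϖ ^ (a : ℤ), (1 : K), ϖ ^ (1 - (a : ℤ))])) := by
        rw [hMeq', mapGL_N₁_eq_of_v_lt_one_of_v hvσ hϖ hκ'' hx2, mapGL_coe_latt_eq t ht, diagonal_three_mul]
        rw [mul_one, mul_one, latt_diagonal_map_zpow_mul_eq hvσ hϖ0, neg_add_eq_sub]
      rw [hMa]
      exact latticeParent_spec_apartment_two_of_v hσ hvσ hϖ hκ (by exact_mod_cast ha)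
    · -- `x₂` a unit: `M` is a child of `κ·L_a`
      have htL : mapGL (t : GL (Fin 3) K) (stdLattice K 3) = latt (Matrix.diagonal ![ϖ ^ (a : ℤ), (1 : K), ϖ ^ (-(a : ℤ))]) := by
        rw [← latt_one, mapGL_coe_latt_eq t ht, Matrix.mul_one, latt_diagonal_map_zpow_eq hvσ hϖ0]
      have hdM : latticeDepth ϖ M = a + 1 := by
        rw [hMeq', latticeDepth_mapGL_of_mem_unitaryInt hκ, latticeDepth_child_of_v hvσ hϖ hκ'' ha ht hx2]
      have hP : latticeParent σ ϖ ((StdForm.antidiagonal 3).over K) M = mapGL (κ : GL (Fin 3) K) (latt (Matrix.diagonal ![ϖ ^ (a : ℤ), (1 : K), ϖ ^ (-(a : ℤ))])) := by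
        rw [hMeq', latticeParent_mapGL_of_mem_unitaryInt hκ, latticeParent_child_of_v hvσ hϖ hκ'' ha ht hx2]
      have hsd := isSelfDualLattice_latt_diagonal_zpow_of_v (K := K) hσ hvσ hϖ (a : ℤ)
      refine ⟨by rw [hP]; exact isVertexLattice_mapGL σ ϖ _ _ κ.2 hsd, ?_, ?_⟩
      · rw [hP, hMeq', mapGL_lt_mapGL_iff, ← htL, mapGL_lt_mapGL_iff]
        exact hXlt
      · rw [hP, hdM, latticeDepth_mapGL_of_mem_unitaryInt hκ, latticeDepth_latt_diagonal_zpow_selfDual hϖ, Int.natAbs_natCast]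


end Literature.NumberTheory.Automorphic.UnitaryLatticeTree

end
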